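import Summits.ResolutionOfSingularities.ResolutionOfSingularities.Theorems.KStage
import Summits.ResolutionOfSingularities.ResolutionOfSingularities.Theorems.KFrames
import Summits.ResolutionOfSingularities.ResolutionOfSingularities.Theorems.KGener
import Summits.ResolutionOfSingularities.ResolutionOfSingularities.Theorems.KGenerFrame
import HarnessLib

/-!
# «TowerDictionaryHolds», slice A (of 2) — the coefficient embedding `rho` and isolation at one stage (D3)

(lens-5 g39, node g39o; critic ROW 232 Q2a / ROW 238 window, door (M-Dict); letters 238a f1–f7 / 238b–k.)
Slice A of the instantiation of the dictionary `towerDictionary_holds : TightDefectClasses.TowerDictionary` (slice B =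
`Theorems/TowerDictionaryHolds.lean`).  §1 `rho : k[u][Z] → K[Z,u]` (`Z ↦ X none`, `u_i ↦ X (some i)`, scalars along `k → K`)
with `rho_framePoly : rho (Z^q + C F) = framePoly q F_K`.  §2 **D3 at one stage** `exists_prime_symb_of_frame`: over a local
`k`-subalgebra `B ⊆ L` with residue field algebraic over `k`, `μ_B : B ⊗_k K → L` injective and a maximal `𝔴 ⊆ B ⊗_k K`, a
`K`-frame of `B̃ = KCarrier.carrier μ_B 𝔴` at `x = e_R r` (`e_R : R ≃+* B` the stalk) whose top form is NOT isolated yields a prime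
`P ≠ 𝔪_R` of `R` with `r` in its symbolic `pᵉ`-th power [Theorems/KGenerFrame.exists_prime_symb_frame_of_not_isolatedTop →
KGener.symb_under → KGener.eq_of_under_eq_maximalIdeal → KGener.symb_under_tensor → KGener.symb_comap_equiv]; slice B contradicts
it with `ForcedTower.isolated` (`KGener.ForcedTower.absurd_of_symb`).
All PROVED, 0 sorry; no new Literature fact; no instance / notation / axiom.  (Sources: Hauser2010 §G; ZariskiSamuel1958 Ch. III §15.)
-/

set_option linter.dupNamespace false

namespace Summit.ResolutionOfSingularities.ResolutionOfSingularities.Theorems.TowerDictionaryHolds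

open IsLocalRing TensorProduct
open Summit.ResolutionOfSingularities.ResolutionOfSingularities.Theorems.TightDefectClasses
open Summit.ResolutionOfSingularities.ResolutionOfSingularities.Theorems.FrameStep

noncomputable section

/-! ## §1 The coefficient embedding `rho : k[u][Z] → K[Z,u]` -/

section Rho

variable (k K : Type) [Field k] [Field K] [Algebra k K]

/-- `rho : k[u₁,u₂,u₃][Z] → K[Z,u₁,u₂,u₃]`: `Z ↦ X none`, `u_i ↦ X (some i)`, scalars along `k → K`
(`(optionEquivLeft k (Fin 3)).symm` followed by `MvPolynomial.map (algebraMap k K)`).  DEFINITION (support, data). -/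
def rho : Polynomial (Base k) →+* MvPolynomial (Option (Fin 3)) K :=
  (MvPolynomial.map (algebraMap k K)).comp
    ((MvPolynomial.optionEquivLeft k (Fin 3)).symm : Polynomial (Base k) →+* MvPolynomial (Option (Fin 3)) k)

/-- `rho` on elements (definitional). -/
theorem rho_apply (x : Polynomial (Base k)) :
    rho k K x = MvPolynomial.map (algebraMap k K) ((MvPolynomial.optionEquivLeft k (Fin 3)).symm x) := rfl

/-- `rho` is injective. -/
theorem rho_injective : Function.Injective (rho k K) :=
  (MvPolynomial.map_injective _ (algebraMap k K).injective).comp (MvPolynomial.optionEquivLeft k (Fin 3)).symm.injective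

/-- `rho Z = X none`. -/
theorem rho_X : rho k K Polynomial.X = MvPolynomial.X none := by
  rw [rho_apply, MvPolynomial.optionEquivLeft_symm_X, MvPolynomial.map_X]

/-- `rho u_j = X (some j)`. -/
theorem rho_C_X (j : Fin 3) : rho k K (Polynomial.C (MvPolynomial.X j)) = MvPolynomial.X (some j) := by
  rw [rho_apply, MvPolynomial.optionEquivLeft_symm_C_X, MvPolynomial.map_X]

/-- `rho c = algebraMap k K c` for scalars. -/
theorem rho_C_C (c : k) : rho k K (Polynomial.C (MvPolynomial.C c)) = MvPolynomial.C (algebraMap k K c) := by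
  rw [rho_apply, MvPolynomial.optionEquivLeft_symm_C_C, MvPolynomial.map_C]

/-- `rho (C F) = F(u)` read in `K[Z,u]` (`rename some` of the base change of `F`). -/
theorem rho_C (F : Base k) :
    rho k K (Polynomial.C F) = MvPolynomial.rename some (MvPolynomial.map (algebraMap k K) F) := by
  have h : ((MvPolynomial.optionEquivLeft k (Fin 3)).symm : Polynomial (Base k) →+* MvPolynomial (Option (Fin 3)) k).comp
      Polynomial.C = (MvPolynomial.rename some : Base k →ₐ[k] MvPolynomial (Option (Fin 3)) k).toRingHom := by
    refine MvPolynomial.ringHom_ext (fun c => ?_) (fun i => ?_)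
    · show (MvPolynomial.optionEquivLeft k (Fin 3)).symm (Polynomial.C (MvPolynomial.C c)) =
        MvPolynomial.rename some (MvPolynomial.C c)
      rw [MvPolynomial.optionEquivLeft_symm_C_C, MvPolynomial.rename_C]
    · show (MvPolynomial.optionEquivLeft k (Fin 3)).symm (Polynomial.C (MvPolynomial.X i)) =
        MvPolynomial.rename some (MvPolynomial.X i)
      rw [MvPolynomial.optionEquivLeft_symm_C_X, MvPolynomial.rename_X]
  have h' : (MvPolynomial.optionEquivLeft k (Fin 3)).symm (Polynomial.C F) = MvPolynomial.rename some F :=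
    RingHom.congr_fun h F
  rw [rho_apply, h', MvPolynomial.map_rename]

/-- `rho (Z^q + F) = framePoly q F_K` — the pure polynomial becomes the frame polynomial of the base change `F_K`. -/
theorem rho_framePoly (q : ℕ) (F : Base k) :
    rho k K (Polynomial.X ^ q + Polynomial.C F) = framePoly q (MvPolynomial.map (algebraMap k K) F) := by
  rw [map_add, map_pow, rho_X, rho_C]
  rfl

end Rho

/-! ## §2 Isolation at one stage (D3) -/

set_option maxHeartbeats 400000 in
/-- **D3 at one stage.**  `B ⊆ L` a local `k`-subalgebra with residue field algebraic over `k`, `μ_B : B ⊗_k K → L` injective,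
`𝔴` a maximal ideal of `B ⊗_k K`, `B̃ = KCarrier.carrier μ_B 𝔴`, `e_R : R ≃+* B` (the stalk), `r ∈ R`, and a `K`-frame `Φ` of `B̃`
at `x = e_R r` whose top form is NOT isolated.  Then some prime `P ≠ 𝔪_R` of `R` has `r` in its symbolic `pᵉ`-th power:
`KGenerFrame.exists_prime_symb_frame_of_not_isolatedTop` gives a prime `Q ≠ 𝔪` of `B̃` (frame-ring description `Frame.hB` +
`FrameStep.mem_frameRing_iff`; the frame unit `Φ.v` moves the membership to `x`); `Q` descends along the localisation
`B ⊗_k K → B̃` (`KCarrier.isLocalization`, `KStage.inclusion_eq`, `KGener.symb_under`; `Q ∩ (B ⊗_k K) ≠ 𝔴` by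
`IsLocalization.map_under` / `AtPrime.map_eq_maximalIdeal`), to `B` (`KGener.eq_of_under_eq_maximalIdeal`: the fibre over the
closed point is a point; `KGener.symb_under_tensor`) and to `R` (`KGener.symb_comap_equiv`, `Ideal.map_comap_of_surjective`). -/
theorem exists_prime_symb_of_frame (p : ℕ) (hp : p.Prime) (e : ℕ) {k K L R : Type} [Field k] [Field K] [Field L]
    [CommRing R] [IsLocalRing R] [Algebra k K] [Algebra k L] [Algebra K L] [IsScalarTower k K L] [CharP K p] [PerfectField K]
    [Algebra.IsSeparable k K] [DecidableEq K] (B : Subalgebra k L) [IsLocalRing B] [Algebra.IsAlgebraic k (ResidueField B)]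
    (hμ : Function.Injective (KStage.mulMap K B).toRingHom) (W : Ideal (B ⊗[k] K)) [W.IsPrime] (hW : W.IsMaximal)
    {Bt : Subring L} [IsLocalRing Bt] (hBt : Bt = KCarrier.carrier (KStage.mulMap K B).toRingHom hμ W) (eR : R ≃+* B)
    (r : R) {x : L} (hx : x = ((eR r : B) : L)) (Φ : KFrames.Frame (Fin 3) K Bt (p ^ e) x)
    (hni : ¬ IsolatedTop (p ^ e) Φ.s.F) :
    ∃ P : Ideal R, P.IsPrime ∧ P ≠ maximalIdeal R ∧ ∃ s ∉ P, s * r ∈ P ^ (p ^ e) := by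
  subst hBt
  have hq : 1 ≤ p ^ e := Nat.one_le_pow _ _ hp.pos
  have hxBt : x ∈ KCarrier.carrier (KStage.mulMap K B).toRingHom hμ W := by
    rw [hx]
    exact KStage.coe_mem_carrier B hμ W _
  -- the frame description of `B̃`
  have hS : ∀ y : L, y ∈ KCarrier.carrier (KStage.mulMap K B).toRingHom hμ W ↔ ∃ a s : MvPolynomial (Option (Fin 3)) K,
      s ∉ MvPolynomial.idealOfVars (Option (Fin 3)) K ∧ y = Φ.θ a / Φ.θ s := fun y => by
    have h := mem_frameRing_iff Φ.θ Φ.hθ (x := y)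
    rwa [Φ.hB] at h
  -- `F(0) = 0` (all monomials of `Φ.s.F` have degree `≥ pᵉ ≥ 1`)
  have hF0 : MvPolynomial.constantCoeff Φ.s.F = 0 := by
    by_contra h0
    have hmem : (0 : Fin 3 →₀ ℕ) ∈ Φ.s.F.support := by
      rw [MvPolynomial.mem_support_iff, ← MvPolynomial.constantCoeff_eq]
      exact h0
    have := Φ.hs 0 hmem
    rw [map_zero] at this
    omega
  obtain ⟨Q, hQ, ⟨y, hyu, hyQ⟩, t, htQ, ht⟩ :=
    KGenerFrame.exists_prime_symb_frame_of_not_isolatedTop _ Φ.θ Φ.hθ hS hp e Φ.s.F hF0 hni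
  haveI := hQ
  -- `x = Φ.v⁻¹ · Φ.θ (Z^{pᵉ} + F)`: transfer the symbolic membership to `x`
  obtain ⟨hvmem, hvunit⟩ := Φ.hv
  have hgenS : KGenerFrame.toSubring _ Φ.θ hS (framePoly (p ^ e) Φ.s.F) =
      (⟨Φ.v, hvmem⟩ : KCarrier.carrier (KStage.mulMap K B).toRingHom hμ W) * ⟨x, hxBt⟩ := Subtype.ext (by
    show Φ.θ (framePoly (p ^ e) Φ.s.F) = Φ.v * x
    exact Φ.hfv)
  obtain ⟨u, hu⟩ := hvunit
  have hsymbS : ∃ t ∉ Q, t * (⟨x, hxBt⟩ : KCarrier.carrier (KStage.mulMap K B).toRingHom hμ W) ∈ Q ^ (p ^ e) := by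
    have htu : t * ↑u ∉ Q := fun hmem =>
      (hQ.mem_or_mem hmem).elim htQ fun hu' => hQ.ne_top (Q.eq_top_of_isUnit_mem hu' u.isUnit)
    refine ⟨t * ↑u, htu, ?_⟩
    have : t * ↑u * (⟨x, hxBt⟩ : KCarrier.carrier (KStage.mulMap K B).toRingHom hμ W) =
        t * KGenerFrame.toSubring _ Φ.θ hS (framePoly (p ^ e) Φ.s.F) := by
      rw [hgenS, hu, mul_assoc]
    rw [this]
    exact ht
  -- descend along the localisation `B ⊗_k K → B̃`
  letI := (KCarrier.toCarrier (KStage.mulMap K B).toRingHom hμ W).toAlgebra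
  haveI := KCarrier.isLocalization (KStage.mulMap K B).toRingHom hμ W
  obtain ⟨b, hb⟩ : ∃ b : B, b = eR r := ⟨_, rfl⟩
  have hxb : algebraMap (B ⊗[k] K) (KCarrier.carrier (KStage.mulMap K B).toRingHom hμ W) (algebraMap B (B ⊗[k] K) b) =
      ⟨x, hxBt⟩ := by
    have h := RingHom.congr_fun (KStage.inclusion_eq B hμ W) b
    rw [RingHom.comp_apply] at h
    rw [h, hb]
    exact Subtype.ext hx.symm
  rw [← hxb] at hsymbS
  obtain ⟨s, hs, hsb⟩ := KGener.symb_under W.primeCompl (S := KCarrier.carrier (KStage.mulMap K B).toRingHom hμ W) hsymbS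
  haveI : (Q.under (B ⊗[k] K)).IsPrime := Ideal.IsPrime.under _ Q
  have hle : Q.under (B ⊗[k] K) ≤ W :=
    (Ideal.comap_mono (IsLocalRing.le_maximalIdeal hQ.ne_top)).trans_eq (IsLocalization.AtPrime.under_maximalIdeal _ W)
  have hne : Q.under (B ⊗[k] K) ≠ W := by
    intro heq
    apply hyQ
    have h1 : Q = maximalIdeal _ :=
      calc Q = (Q.under (B ⊗[k] K)).map (algebraMap (B ⊗[k] K) _) := (IsLocalization.map_under W.primeCompl _ Q).symm
        _ = W.map (algebraMap (B ⊗[k] K) _) := congrArg (Ideal.map _) heq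
        _ = maximalIdeal _ := IsLocalization.AtPrime.map_eq_maximalIdeal W _
    rw [h1]
    exact (IsLocalRing.mem_maximalIdeal _).mpr hyu
  -- descend to `B` (the fibre over the closed point is a point): an opaque prime `P₁` of `B`
  obtain ⟨P₁, hP₁ne, hP₁, s', hs', hs'b⟩ :
      ∃ P₁ : Ideal B, P₁ ≠ maximalIdeal B ∧ P₁.IsPrime ∧ ∃ s ∉ P₁, s * b ∈ P₁ ^ (p ^ e) :=
    ⟨_, fun heq => hne (KGener.eq_of_under_eq_maximalIdeal k K B hW.ne_top hle heq), Ideal.comap_isPrime _ _,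
      KGener.symb_under_tensor k K B (Q.under (B ⊗[k] K)) ⟨s, hs, hsb⟩⟩
  haveI := hP₁
  -- and to `R ≃ B`
  have hebr : eR r = b := hb.symm
  obtain ⟨s'', hs'', hs''f⟩ := KGener.symb_comap_equiv eR P₁ (x := r) ⟨s', hs', by rw [hebr]; exact hs'b⟩
  have hPne : P₁.comap eR ≠ maximalIdeal R := by
    intro heq
    apply hP₁ne
    rw [← Ideal.map_comap_of_surjective eR eR.surjective P₁, heq, IsLocalRing.map_ringEquiv_maximalIdeal]
  exact ⟨P₁.comap eR, Ideal.comap_isPrime eR P₁, hPne, s'', hs'', hs''f⟩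

end

end Summit.ResolutionOfSingularities.ResolutionOfSingularities.Theorems.TowerDictionaryHolds
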